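import Literature.AlgebraicGeometry.Morphisms.ClosedImmersionNearFibre
import HarnessLib

/-!
# EGA III 4.6.7 (ii) with the fibre presented by arbitrary cartesian squares

Topic `AlgebraicGeometry/Morphisms`; namespace `Literature.AlgebraicGeometry.Morphisms`. THEOREMS ONLY (no definition, no named
fact, no instance, no `sorry`). Companion of ★ `Morphisms/ClosedImmersionNearFibre` (EGA III 4.6.7 (ii): a proper `S`-morphism
`g : X → P` which is a closed immersion on the fibre over `s` is a closed immersion over a neighbourhood of `s`).

There the fibre hypothesis is stated either pointwise (`g⁻¹(p) → Spec κ(p)` for `p` over `s`) or on Mathlib's fibres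
`f.fiber s → q.fiber s` (`pullback f (S.fromSpecResidueField s)`). Consumers usually hold the fibres in another presentation —
e.g. over `S = Spec A` as base changes along `Spec (A → κ(𝔭))` with `κ(𝔭) = 𝔭.asIdeal.ResidueField`, or as `X ×_S S₀` for
some `S₀ → S` with a `κ(s)`-point over `s`. This file provides that flexibility:

* `isClosedImmersion_fiberToSpecResidueField_of_isPullback` — for ANY `ι₀ : S₀ → S` through which `Spec κ(s) → S` factors and
  ANY cartesian squares `X₀ = X ×_S S₀`, `P₀ = P ×_S S₀`: a compatible closed immersion `g₀ : X₀ → P₀` makes every pointwise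
  fibre `g⁻¹(p) → Spec κ(p)` (`p` over `s`) a closed immersion;
* **`exists_isClosedImmersion_morphismRestrict_preimage_of_isPullback`** — hence EGA III 4.6.7 (ii) in that presentation;
* **`exists_isClosedImmersion_pullbackMap_away_of_isPullback`** — over `Spec A` with `S₀ = Spec κ(𝔭)` presented by
  `Spec (A → κ(𝔭))` (Mathlib `Spec.map_residueFieldIso_inv_eq_fromSpecResidueField`): conclusion «`X ×_A A_r → P ×_A A_r` is a
  closed immersion for some `r ∉ 𝔭`».

Cell `hodgecm-mathlib`, (h2) leaf (A)/(B) seam: this is the hypothesis shape produced by ★-to-be `GeneratingSections.comap` /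
`toProj_comp_SpecMap_algebraMap` + ★ `ProjBaseChangeRing.isPullback_projMap'`. Count-neutral capital (HC_CM is proved only modulo
the 7 printed citations until rung 0 closes).

## References
* A. Grothendieck, J. Dieudonné, *EGA III₁* (1961), Prop. 4.6.7 (ii). [EGAIII1]
-/

universe u

open CategoryTheory CategoryTheory.Limits AlgebraicGeometry TopologicalSpace

namespace Literature.AlgebraicGeometry.Morphisms

/-! ### Flexible presentation of the fibre: any cartesian squares over `S₀ → S` with a `κ(s)`-point -/

section FlexibleFibre

variable {X P S : Scheme.{u}} (f : X ⟶ S) (q : P ⟶ S) (g : X ⟶ P)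

/-- **Fibre morphism ⇒ pointwise fibres, for any presentation of the fibre.** Let `g ≫ q = f`, let `ι₀ : S₀ → S` be any
morphism through which `Spec κ(s) → S` factors (`σ ≫ ι₀ = Spec κ(s) → S`; e.g. `S₀ = Spec κ(𝔭)` presented by
`Spec (A → κ(𝔭))` for `S = Spec A`), and let `X₀ = X ×_S S₀`, `P₀ = P ×_S S₀` be given by ARBITRARY cartesian squares. If a
morphism `g₀ : X₀ → P₀` compatible with the projections is a closed immersion, then the scheme-theoretic fibre
`g⁻¹(p) → Spec κ(p)` at every point `p` of `P` over `s` is a closed immersion (base change of `g₀` along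
`Spec κ(p) → P₀`). [cite: EGAIII1, Prop. 4.6.7 (ii)] -/
theorem isClosedImmersion_fiberToSpecResidueField_of_isPullback (hg : g ≫ q = f) (s : S) {S₀ X₀ P₀ : Scheme.{u}}
    {ι₀ : S₀ ⟶ S} (σ : Spec (S.residueField s) ⟶ S₀) (hσ : σ ≫ ι₀ = S.fromSpecResidueField s)
    {iX : X₀ ⟶ X} {f₀ : X₀ ⟶ S₀} (HX : IsPullback iX f₀ f ι₀) {iP : P₀ ⟶ P} {q₀ : P₀ ⟶ S₀}
    (HP : IsPullback iP q₀ q ι₀) (g₀ : X₀ ⟶ P₀) (h₁ : g₀ ≫ iP = iX ≫ g) (h₂ : g₀ ≫ q₀ = f₀)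
    (hg₀ : IsClosedImmersion g₀) (p : P) (hp : q p = s) : IsClosedImmersion (g.fiberToSpecResidueField p) := by
  subst hp
  -- `X₀ = X ×_P P₀`
  have big : IsPullback (g₀ ≫ q₀) iX ι₀ (g ≫ q) := by
    rw [h₂, hg]; exact HX.flip
  have SQ1 : IsPullback g₀ iX iP g := IsPullback.of_right big h₁ HP.flip
  -- `Spec κ(p) → P₀`
  have w : P.fromSpecResidueField p ≫ q = (Spec.map (q.residueFieldMap p) ≫ σ) ≫ ι₀ := by
    rw [Category.assoc, hσ, Scheme.Hom.SpecMap_residueFieldMap_fromSpecResidueField]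
  set α : Spec (P.residueField p) ⟶ P₀ := HP.lift (P.fromSpecResidueField p) (Spec.map (q.residueFieldMap p) ≫ σ) w
    with hαdef
  have hα : α ≫ iP = P.fromSpecResidueField p := HP.lift_fst _ _ _
  have SQ2 : IsPullback (g.fiberι p) (g.fiberToSpecResidueField p) g (P.fromSpecResidueField p) :=
    IsPullback.of_hasPullback g (P.fromSpecResidueField p)
  -- `g⁻¹(p) → X₀`
  set γ : g.fiber p ⟶ X₀ :=
    SQ1.lift (g.fiberToSpecResidueField p ≫ α) (g.fiberι p) (by rw [Category.assoc, hα, ← SQ2.w]) with hγdef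
  have hγ₁ : γ ≫ g₀ = g.fiberToSpecResidueField p ≫ α := SQ1.lift_fst _ _ _
  have hγ₂ : γ ≫ iX = g.fiberι p := SQ1.lift_snd _ _ _
  have big' : IsPullback (γ ≫ iX) (g.fiberToSpecResidueField p) g (α ≫ iP) := by
    rw [hγ₂, hα]; exact SQ2
  have sq : IsPullback γ (g.fiberToSpecResidueField p) g₀ α := IsPullback.of_right big' hγ₁ SQ1.flip
  exact MorphismProperty.IsStableUnderBaseChange.of_isPullback sq hg₀

/-- **EGA III 4.6.7 (ii), flexible fibre presentation.** `f` proper, `q` separated, `g ≫ q = f`; fibres over `s` presented by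
arbitrary cartesian squares over some `ι₀ : S₀ → S` through which `Spec κ(s) → S` factors; if `g₀ : X₀ → P₀` is a closed
immersion then `g` is a closed immersion over `q⁻¹(U)` for an open `U ∋ s`. [cite: EGAIII1, Prop. 4.6.7 (ii)] -/
theorem exists_isClosedImmersion_morphismRestrict_preimage_of_isPullback (hg : g ≫ q = f) [IsProper f] [IsSeparated q]
    (s : S) {S₀ X₀ P₀ : Scheme.{u}} {ι₀ : S₀ ⟶ S} (σ : Spec (S.residueField s) ⟶ S₀)
    (hσ : σ ≫ ι₀ = S.fromSpecResidueField s) {iX : X₀ ⟶ X} {f₀ : X₀ ⟶ S₀} (HX : IsPullback iX f₀ f ι₀)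
    {iP : P₀ ⟶ P} {q₀ : P₀ ⟶ S₀} (HP : IsPullback iP q₀ q ι₀) (g₀ : X₀ ⟶ P₀) (h₁ : g₀ ≫ iP = iX ≫ g)
    (h₂ : g₀ ≫ q₀ = f₀) (hg₀ : IsClosedImmersion g₀) :
    ∃ U : S.Opens, s ∈ U ∧ IsClosedImmersion (g ∣_ q ⁻¹ᵁ U) :=
  exists_isClosedImmersion_morphismRestrict_preimage_of_fiber f q g hg s
    (isClosedImmersion_fiberToSpecResidueField_of_isPullback f q g hg s σ hσ HX HP g₀ h₁ h₂ hg₀)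

/-- **EGA III 4.6.7 (ii) over `Spec A`, fibre presented over `Spec κ(𝔭) = Spec (A → κ(𝔭))`.** `f : X → Spec A` proper,
`q : P → Spec A` separated, `g ≫ q = f`; `X₀`, `P₀` the base changes along `Spec κ(𝔭) → Spec A` given by ANY cartesian
squares (`κ(𝔭) = 𝔭.asIdeal.ResidueField`), `g₀ : X₀ → P₀` a compatible closed immersion. Then for some `r ∉ 𝔭` the base change
`X ×_A A_r → P ×_A A_r` of `g` is a closed immersion. [cite: EGAIII1, Prop. 4.6.7 (ii)] -/
theorem exists_isClosedImmersion_pullbackMap_away_of_isPullback {A : Type u} [CommRing A] {X P : Scheme.{u}}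
    (f : X ⟶ Spec (.of A)) (q : P ⟶ Spec (.of A)) (g : X ⟶ P) (hg : g ≫ q = f) [IsProper f] [IsSeparated q]
    (𝔭 : PrimeSpectrum A) {X₀ P₀ : Scheme.{u}} {iX : X₀ ⟶ X} {f₀ : X₀ ⟶ Spec (.of 𝔭.asIdeal.ResidueField)}
    (HX : IsPullback iX f₀ f (Spec.map (CommRingCat.ofHom (algebraMap A 𝔭.asIdeal.ResidueField))))
    {iP : P₀ ⟶ P} {q₀ : P₀ ⟶ Spec (.of 𝔭.asIdeal.ResidueField)}
    (HP : IsPullback iP q₀ q (Spec.map (CommRingCat.ofHom (algebraMap A 𝔭.asIdeal.ResidueField))))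
    (g₀ : X₀ ⟶ P₀) (h₁ : g₀ ≫ iP = iX ≫ g) (h₂ : g₀ ≫ q₀ = f₀) (hg₀ : IsClosedImmersion g₀) :
    ∃ r : A, r ∉ 𝔭.asIdeal ∧ ∀ e₁ e₂, IsClosedImmersion
      (pullback.map f (Spec.map (CommRingCat.ofHom (algebraMap A (Localization.Away r)))) q
        (Spec.map (CommRingCat.ofHom (algebraMap A (Localization.Away r)))) g (𝟙 _) (𝟙 _) e₁ e₂) :=
  exists_isClosedImmersion_pullbackMap_away_of_fiber f q g hg 𝔭
    (isClosedImmersion_fiberToSpecResidueField_of_isPullback f q g hg 𝔭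
      (Spec.map (Scheme.Spec.residueFieldIso (.of A) 𝔭).inv)
      (Scheme.Spec.map_residueFieldIso_inv_eq_fromSpecResidueField (.of A) 𝔭) HX HP g₀ h₁ h₂ hg₀)

end FlexibleFibre

end Literature.AlgebraicGeometry.Morphisms
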